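import Summits.Ventures.AbcShadow.SH02.Statement
import Summits.Ventures.AbcShadow.SH02.KillData

/-!
# Venture AbcShadow — ROW SH-02: `x² − 73^{2k+1} = yⁿ`, `73 ∤ x`, `y` odd, `n ≥ 3` ⇒ `10² − 73 = 3³` (reduction theorem)

HONEST FRAMING. A row of the work-bound cell `abc-shadow` (typer seat `abc-shadow-typ-2`): a CONDITIONAL,
typed/kernel-checked REDUCTION, no claim on abc or on any summit, no side on IUT. `sh02_d73_of` derives the target
`D73` (`SH02/Statement.lean`) from EXACTLY these hypotheses on an arbitrary model `M : BS23Model` (meaningful for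
the intended model only, see `SH02/BS23Package.lean`):

* `hP : M.BS23Package` — CITED print package [BS23] = M. A. Bennett, S. Siksek, Algebra & Number Theory 17 (2023):
  [Prop. 14.1 + Table 3] (`y` odd, prime `n ≥ 7` ⇒ `n > 1000` and `ρ̄_{G_{x,k},n} ∼ ρ̄_{E,n}`, `E ∈ {2336a1, 2336b1}`),
  [Lemma 14.2 + Lemma 7.1 (rational clause)] (`⇒ n ∣ a − a_ℓ(E)` for some `a ∈ T_ℓ`, every prime `ℓ ∤ 2·73`),
  [Thm 3, `q = 73`] (`3 ≤ n ≤ 1000`: the seven printed solutions);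
* `h1 : KillCert 7841 1 (−158)`, `h0 : KillCert 41189 0 (−284)` — the kill-prime propositions of
  `SH02/KillData.lean`: COMPUTED by the cell (inv-6 K4-73/73bis, crit-1 re-check PASS 8/8 kit j319553, third path
  97fd313139c017bc, eng-2 j320506) and supplied either from the transcribed record (`sh02_d73_of_data`, hypotheses
  `KillData7841`, `KillData41189` — the analogue of SH-01's `DataComplete`) or, later, by kernel certificates.

Everything else is PROVED here, in the kernel — the chain of the cell's memo crit-1-SH02-K4-73.md §3:
(i) `gcd(x, y) = 1` from `73 ∤ x`; (ii) descent on the exponent: `n ≤ 1000` is [Thm 3] (only `(k, y, n) = (0, 3, 3)`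
has `y` odd, then `x² = 100`); for `n > 1000` either `4 ∣ n` (then `(x, y^{n/4})` is a `y`-odd solution of exponent
`4`, none by [Thm 3]) or an odd prime `p ∣ n`: if `p ≤ 1000` then `(x, y^{n/p})` forces `y^{n/p} = 3` with `n/p ≥ 2`,
absurd; if `p > 1000` then (iii) [Prop. 14.1] gives `ρ̄_{G,p} ∼ ρ̄_{E,p}`, [Lemma 14.2] at `ℓ = 7841` (`k` odd) or
`ℓ = 41189` (`k` even) gives `p ∣ a − c` for some `a ∈ T_ℓ = S_ℓ` (`73` is a non-square mod `ℓ`), and the kill-prime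
proposition says `0 < |a − c| < 1000 < p` — contradiction. Words for this row: typed/kernel-checked REDUCTION;
print inputs are NAMED hypotheses; the kill-prime data is COMPUTED and enters as the hypotheses `KillCert`/`KillData`;
D73 is the cell's DERIVED statement, print's status word for `q = 73`, `y` odd, `n > 1000` remains OPEN; adjacent
(Lebesgue–Nagell type), NOT abc; AI-typed, weaker than expert refereeing of the cited inputs.
-/

namespace Summit.Ventures.AbcShadow

/-- `gcd(x, y) = 1` for a solution of `x² − 73^{2k+1} = yⁿ` (`n ≥ 1`) with `73 ∤ x`: a common prime factor would
divide `73^{2k+1}`. [folklore] -/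
theorem d73_isCoprime {x y : ℤ} {k n : ℕ} (heq : x ^ 2 - 73 ^ (2 * k + 1) = y ^ n) (h73 : ¬ (73 : ℤ) ∣ x)
    (hn : 0 < n) : IsCoprime x y := by
  have hx73 : IsCoprime x (73 : ℤ) := by
    rw [Int.isCoprime_iff_gcd_eq_one]
    have h' : ¬ 73 ∣ x.natAbs := fun h => h73 (Int.natCast_dvd.mpr h)
    have hcop : Nat.Coprime 73 x.natAbs := (Nat.Prime.coprime_iff_not_dvd (by norm_num)).mpr h'
    exact hcop.symm
  have hpow : IsCoprime x ((73 : ℤ) ^ (2 * k + 1)) := hx73.pow_right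
  have hrw : (73 : ℤ) ^ (2 * k + 1) = -(y ^ n) + x * x := by rw [← heq]; ring
  rw [hrw] at hpow
  have hneg : IsCoprime x (-(y ^ n)) := hpow.of_add_mul_left_right
  exact (IsCoprime.pow_right_iff hn).mp ((IsCoprime.neg_right_iff x (y ^ n)).mp hneg)

/-- **Small exponents are print's [BS23, Thm 3]**: a solution with `73 ∤ x`, `y` odd, `3 ≤ n ≤ 1000` has
`(k, y, n) = (0, 3, 3)` (symmetrise `x ↦ |x| > 0`, look the triple up in the printed list, keep the odd-`y` entry).
[cite: BennettSiksek2023, Thm 3 p.1791] -/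
theorem d73_small (h3 : BS23Thm3Q73) {x y : ℤ} {k n : ℕ} (heq : x ^ 2 - 73 ^ (2 * k + 1) = y ^ n)
    (h73 : ¬ (73 : ℤ) ∣ x) (hy : Odd y) (hn3 : 3 ≤ n) (hn : n ≤ 1000) : k = 0 ∧ y = 3 ∧ n = 3 := by
  have hx0 : x ≠ 0 := fun h => h73 (h ▸ dvd_zero 73)
  have key := h3 |x| y k n (by rwa [sq_abs]) (abs_pos.mpr hx0) (by rwa [dvd_abs]) hn3 hn
  exact bs23Thm3ListQ73_odd key hy

/-- **A kill prime kills**: under [Lemma 14.2 (+ 7.1)], if `KillCert ℓ v c` holds and `k ≡ v (mod 2)`, then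
`ρ̄_{G_{x,k},p} ∼ ρ̄_{E,p}` with `E` a Table-3 curve is impossible for a prime `p > 1000`: Lemma 14.2 gives `a ∈ T_ℓ = S_ℓ`
with `p ∣ a − a_ℓ(E) = a − c`, but `0 < |a − c| < 1000 < p`. [cite: BennettSiksek2023, Lemma 14.2 p.1825] -/
theorem killCert_kills (M : BS23Model) (h142 : M.BS23Lemma142) {ℓ v : ℕ} {c : ℤ} (hK : KillCert ℓ v c)
    {x y : ℤ} {k p : ℕ} {E : WeierstrassCurve ℤ} (heq : x ^ 2 - 73 ^ (2 * k + 1) = y ^ p) (hcop : IsCoprime x y)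
    (h73 : ¬ (73 : ℤ) ∣ x) (hy : Odd y) (hp : p.Prime) (hp7 : 7 ≤ p) (hp1000 : 1000 < p)
    (hE : E ∈ bs23Table3Q73) (hiso : M.IsoModN 73 x k p E) (hv : k % 2 = v) : False := by
  obtain ⟨hℓ, hℓ2, hℓ73, hnsq, ha, hb, hS⟩ := hK
  obtain ⟨a, haT, hdvd⟩ := h142 x y k p E heq hcop h73 hy hp hp7 hE hiso ℓ hℓ hℓ2 hℓ73
  rw [hv, bs23T_eq_of_not_isSquare v hnsq] at haT
  have hc : apTrace ℓ (reduceMod ℓ E) = c := by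
    rcases (mem_bs23Table3Q73 E).mp hE with rfl | rfl
    · exact ha
    · exact hb
  rw [hc] at hdvd
  obtain ⟨hne, hlt⟩ := hS a haT
  have hpos : 0 < |a - c| := abs_pos.mpr (sub_ne_zero.mpr hne)
  have hle : (p : ℤ) ≤ |a - c| := Int.le_of_dvd hpos ((dvd_abs _ _).mpr hdvd)
  omega

/-- **No prime exponent `p > 1000`** (the case print leaves open): [Prop. 14.1 + Table 3] gives `E ∈ {2336a1, 2336b1}`
with `ρ̄_{G,p} ∼ ρ̄_{E,p}`; the parity of `k` selects the kill prime (`k` even: `KillCert ℓ₀ 0 c₀`, `k` odd: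
`KillCert ℓ₁ 1 c₁`). [cite: BennettSiksek2023, Prop 14.1 pp.1823-1824; Lemma 14.2 p.1825] -/
theorem d73_no_large_prime (M : BS23Model) (h141 : M.BS23Prop141) (h142 : M.BS23Lemma142)
    {ℓ₀ ℓ₁ : ℕ} {c₀ c₁ : ℤ} (hK0 : KillCert ℓ₀ 0 c₀) (hK1 : KillCert ℓ₁ 1 c₁)
    {x y : ℤ} {k p : ℕ} (heq : x ^ 2 - 73 ^ (2 * k + 1) = y ^ p) (h73 : ¬ (73 : ℤ) ∣ x) (hy : Odd y)
    (hp : p.Prime) (hp1000 : 1000 < p) : False := by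
  have hcop : IsCoprime x y := d73_isCoprime heq h73 hp.pos
  obtain ⟨-, E, hE, hiso⟩ := h141 x y k p heq hcop h73 hy hp (by omega)
  rcases Nat.mod_two_eq_zero_or_one k with hk | hk
  · exact killCert_kills M h142 hK0 heq hcop h73 hy hp (by omega) hp1000 hE hiso hk
  · exact killCert_kills M h142 hK1 heq hcop h73 hy hp (by omega) hp1000 hE hiso hk

/-- **Row SH-02, generic kill primes**: [BS23] package + one kill-prime proposition per parity class of `k` ⇒ `D73`.
The descent on `n` (kernel): `n ≤ 1000` by [Thm 3]; `n = 2^e > 1000` via the exponent-`4` sub-solution `(x, y^{n/4})`;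
otherwise an odd prime `p ∣ n` and the exponent-`p` sub-solution `(x, y^{n/p})` — [Thm 3] if `p ≤ 1000` (then
`y^{n/p} = 3`, impossible as `n/p ≥ 2`), `d73_no_large_prime` if `p > 1000`.
[cite: BennettSiksek2023, Thm 3 p.1791; Prop 14.1 pp.1823-1824; Lemma 14.2 p.1825] -/
theorem sh02_d73_of_killCert (M : BS23Model) (hP : M.BS23Package) {ℓ₀ ℓ₁ : ℕ} {c₀ c₁ : ℤ}
    (hK0 : KillCert ℓ₀ 0 c₀) (hK1 : KillCert ℓ₁ 1 c₁) : D73 := by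
  obtain ⟨h141, h142, h3⟩ := hP
  intro x y n k heq h73 hy hn3
  by_cases hn : n ≤ 1000
  · obtain ⟨rfl, rfl, rfl⟩ := d73_small h3 heq h73 hy hn3 hn
    refine ⟨?_, rfl, rfl, rfl⟩
    have hx : x ^ 2 = 10 ^ 2 := by norm_num at heq; linarith [heq]
    exact sq_eq_sq_iff_eq_or_eq_neg.mp hx
  · exfalso
    replace hn : 1000 < n := not_le.mp hn
    rcases Nat.eq_two_pow_or_exists_odd_prime_and_dvd n with ⟨e, rfl⟩ | ⟨p, hp, hpn, hpodd⟩
    · -- `n = 2^e > 1000`: the exponent-4 sub-solution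
      have he : 2 ≤ e := by
        by_contra he
        interval_cases e <;> simp at hn
      obtain ⟨m, hm⟩ : 4 ∣ 2 ^ e := by
        rw [show (4 : ℕ) = 2 ^ 2 by norm_num]
        exact pow_dvd_pow 2 he
      have heq' : x ^ 2 - 73 ^ (2 * k + 1) = (y ^ m) ^ 4 := by rw [heq, hm, mul_comm, pow_mul]
      obtain ⟨-, -, h4⟩ := d73_small h3 heq' h73 hy.pow (by norm_num) (by norm_num)
      omega
    · -- an odd prime `p ∣ n`: the exponent-`p` sub-solution
      obtain ⟨m, hm⟩ := hpn
      have heq' : x ^ 2 - 73 ^ (2 * k + 1) = (y ^ m) ^ p := by rw [heq, hm, mul_comm, pow_mul]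
      have hy' : Odd (y ^ m) := hy.pow
      by_cases hp1000 : p ≤ 1000
      · have hp2 : p ≠ 2 := by rintro rfl; exact absurd hpodd (by decide)
        have hp3 : 3 ≤ p := by have := hp.two_le; omega
        obtain ⟨-, hym, rfl⟩ := d73_small h3 heq' h73 hy' hp3 hp1000
        -- `y^m = 3` with `m ≥ 2` (as `n = 3m > 1000`): impossible
        have hm2 : 2 ≤ m := by omega
        have habs : y.natAbs ^ m = 3 := by
          have := congrArg Int.natAbs hym
          rwa [Int.natAbs_pow] at this
        have := ((Nat.Prime.pow_eq_iff Nat.prime_three).mp habs).2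
        omega
      · exact d73_no_large_prime M h141 h142 hK0 hK1 heq' h73 hy' hp (not_le.mp hp1000)

/-- **Row SH-02 (reduction theorem).** Under the named hypotheses — the cited [BS23] print package (`BS23Package` =
[Prop. 14.1 + Table 3] ∧ [Lemma 14.2 + Lemma 7.1] ∧ [Thm 3, `q = 73`]) and the two COMPUTED kill-prime propositions
(`ℓ = 7841` kills `k` odd with `c = −158`, `ℓ = 41189` kills `k` even with `c = −284`) — every solution of
`x² − 73^{2k+1} = yⁿ` with `73 ∤ x`, `y` odd, `n ≥ 3` is `(±10)² − 73 = 3³`, i.e. `D73`. ADJACENT, NOT abc; D73 is the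
cell's DERIVED statement, OPEN in print. [cite: BennettSiksek2023, Thm 3 p.1791 (the y-odd, n > 1000 case it leaves open, conditionally on the named inputs)] -/
theorem sh02_d73_of (M : BS23Model) (hP : M.BS23Package) (h1 : KillCert 7841 1 (-158))
    (h0 : KillCert 41189 0 (-284)) : D73 :=
  sh02_d73_of_killCert M hP h0 h1

/-- **Row SH-02 from the transcribed record**: the same with the kill-prime propositions supplied by the COMPUTED
data hypotheses `KillData7841`, `KillData41189` of `SH02/KillData.lean` (the analogue of SH-01's `DataComplete`;
primality, `(73/ℓ) = −1` and the interval arithmetic are kernel-checked there).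
[cite: BennettSiksek2023, Thm 3 p.1791 (the y-odd, n > 1000 case it leaves open, conditionally on the named inputs)] -/
theorem sh02_d73_of_data (M : BS23Model) (hP : M.BS23Package) (hD1 : KillData7841) (hD0 : KillData41189) : D73 :=
  sh02_d73_of M hP (killCert_7841_of_data hD1) (killCert_41189_of_data hD0)

end Summit.Ventures.AbcShadow
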